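import Summits.ResolutionOfSingularities.ResolutionOfSingularities.Theorems.HilbertSamuelEliminationSigmaMaxModificationsCorridor3WLadderBirthFormsNear
import Literature.AlgebraicGeometry.Resolution.RidgeCone
import Mathlib.Algebra.MvPolynomial.Funext
import HarnessLib

/-!
# [OURS · L1 W4.2] (b-end)₃ W-TOP BIRTHS — D9 part (ii): the ONE-STEP birth law for a CURVE centre (the BINARY port of
# `birthNear` / `birthTidy` on the fibre over the chain point)
# (cell res-hironaka, LADDER-RESOLUTION rung L; slot W4.2, crux chain w42 `SigmaMaxModificationsCorridor3`
# stmt-ResolutionOfSingularities-19249; `--supports stmt-ResolutionOfSingularities-19249 --as helper`; res-L1-w42-plan-1 W4.2 DEAL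
# object D9 / RULINGS v3.12-1 (C) 2026-08-27T08:12:41Z, hand res-D-pv-002)

Everything here is OURS (elementary `MvPolynomial` algebra over a field; by name over `…BirthForms` p506417 / `…BirthFormsNear`
p507123, whose §B/§C/§E helpers were stated for an arbitrary index type); NOT a statement of Hironaka's manuscript [Hironaka2017]
nor of [CossartJannsenSaito2020]; no `Literature.…` named fact; never a `Theses/…` import. AI-written; no expert review; AI
review is weaker than expert review.

## Setting (res-type-067's step-geometry finding 08:12:03Z, plan-1 RULINGS v3.12-1 (C))

At a (b-end)₃ step of a never-isolated chain the centre germ at `x_n` is a regular CURVE `D` or a SURFACE, never the point.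
For a CURVE `D = V(Y, U₁, U₂)` (frame adapted to `D`, `U₀` the parameter of `D`) the blow-up has the two charts `U_j ≠ 0`,
`j ∈ {1, 2}`: `U_l ↦ U_j·U_l` for the OTHER transversal letter `l`, `U_j ↦ U_j`, `U₀` UNTOUCHED; the near directions over
`x_n` live on `ℙ(Dir_{x_n}/T_{x_n}D) ≅ ℙ¹` (coordinates `[U₁ : U₂]`), and the fibre-birth event is «`ℙ¹` WHOLLY near».
RESTRICTING TO THE FIBRE `U₀ = 0` commutes with the chart and keeps nearness (§1), after which the one-step law is the
BINARY (`Fin 2`) version of idea-1's §8 law (§2–§3). All statements are INLINE over `MvPolynomial (Fin 2) k` (the typed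
`VanishesToOrder` / `BirthNear` / `BirthTidy` are `Fin 3`-specific definitions; no new definition is introduced here).

## What is proved

* §1 `Birth.restrictFibre_aeval_curveChart` — with `ρ : U₀ ↦ 0, U_{l+1} ↦ V_l` (`Fin.cases 0 X`) and the curve chart
  `χ^D_j : U₀ ↦ U₀, U_{j+1} ↦ U_{j+1}, U_{l+1} ↦ U_{j+1}·U_{l+1}`: `ρ ∘ χ^D_j = χ_j ∘ ρ` (the point-chart `χ_j` of `Fin 2`);
  `Birth.restrictFibre_translate` — `ρ (c′(U + B)) = (ρ c′)(V + b)` for `B = (0, b)`; `Birth.lowOrder_restrictFibre` — low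
  homogeneous components stay zero under `ρ`. So «`c′` near at the point `(U₀, U_j, U_l) = (0, 0, b)`» ⇒ «`ρ c′` near at `(0, b)`».
* §2 `Birth.birthNear₂` — the BINARY `birthNear`: `c′·V_j^q = χ_j(c)` and `c′` of order `≥ q` at `b` (`b_j = 0`) ⇒ the
  degree-`d` form `in_d(c)` vanishes to order `2q − d` at `b̂ = (b, b_j := 1)` (same proof as p507123 §E, index type `Fin 2`).
* §3 `Birth.birthTidy₂` — the BINARY `birthTidy`: a non-zero binary form of degree `d` with `d < 2μ` does not vanish to order
  `μ` at two linearly independent vectors (exponent lemma of p506417 §B at the two letters: `μ + s₀ ≤ d`, `μ + s₁ ≤ d`).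
* §3 `Birth.not_linearIndependent_of_near₂` — ONE-STEP CURVE-CENTRE LAW: below the band `3d < 4q` (`δ = d/q < 4/3`) two near
  points of `ℙ¹ = ℙ(Dir/T_D)`, each read in its own chart, never have linearly independent directions: AT MOST ONE near
  direction over `x_n`; in particular «`ℙ¹` wholly near» (a RULED fibre birth) is impossible below `4/3` unless `in_d(c) = 0`
  on the fibre — the graded event res-type-067's `BirthDictionary3` (curve form) names: the `D`-transversal initial forms of
  the band indices VANISH AT the point `x_n ∈ D`.
* §4 (append) `Birth.eq_zero_of_wholly_near₂` — over an infinite field, «`ℙ¹` WHOLLY near» to a positive order (`δ < 2`) forces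
  the binary form to be `0`: a RULED fibre birth needs the `D`-transversal initial forms of ALL indices with `δ_i < 2` to vanish
  at `x_n` (forms scale + `MvPolynomial.funext`).
-/

noncomputable section

set_option linter.dupNamespace false

namespace Summit.ResolutionOfSingularities.ResolutionOfSingularities.Theorems.SigmaMaxModificationsCorridor3.Birth

open MvPolynomial Finset
open Literature.AlgebraicGeometry.Resolution
open Literature.AlgebraicGeometry.Resolution.PointBlowup (translate chartTransform chartExponent degree_chartExponent)
open Literature.AlgebraicGeometry.Resolution.HauserPerlega2024 (coeff_chartExponent_chartTransform)
open Literature.AlgebraicGeometry.Hironaka2017.EdgeAlgebra (isHomogeneous_aeval_linear homogeneousComponent_aeval_linear)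

/-! ## §1. Restriction to the fibre `U₀ = 0` -/

section Restrict

variable {k : Type} [Field k]

/-- **The fibre restriction commutes with the curve chart**: `ρ (χ^D_j c) = χ_j (ρ c)` where `ρ : U₀ ↦ 0, U_{l+1} ↦ V_l` and
`χ^D_j` is the chart `U_{j+1} ≠ 0` of the blow-up along `D = V(Y, U₁, U₂)` (`U₀` untouched). [folklore] -/
theorem restrictFibre_aeval_curveChart (j : Fin 2) (c : MvPolynomial (Fin 3) k) :
    aeval (Fin.cases (0 : MvPolynomial (Fin 2) k) (fun l => X l) : Fin 3 → MvPolynomial (Fin 2) k)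
      (aeval (Fin.cases (X 0 : MvPolynomial (Fin 3) k)
        (fun l => if l = j then (X j.succ : MvPolynomial (Fin 3) k) else X j.succ * X l.succ) :
          Fin 3 → MvPolynomial (Fin 3) k) c) =
    aeval (fun l : Fin 2 => if l = j then (X j : MvPolynomial (Fin 2) k) else X j * X l)
      (aeval (Fin.cases (0 : MvPolynomial (Fin 2) k) (fun l => X l) : Fin 3 → MvPolynomial (Fin 2) k) c) := by
  have hfun : (fun i : Fin 3 => aeval (Fin.cases (0 : MvPolynomial (Fin 2) k) (fun l => X l) : Fin 3 → MvPolynomial (Fin 2) k)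
      ((Fin.cases (X 0 : MvPolynomial (Fin 3) k)
        (fun l => if l = j then (X j.succ : MvPolynomial (Fin 3) k) else X j.succ * X l.succ) :
          Fin 3 → MvPolynomial (Fin 3) k) i)) =
      fun i : Fin 3 => aeval (fun l : Fin 2 => if l = j then (X j : MvPolynomial (Fin 2) k) else X j * X l)
        ((Fin.cases (0 : MvPolynomial (Fin 2) k) (fun l => X l) : Fin 3 → MvPolynomial (Fin 2) k) i) := by
    funext i
    refine Fin.cases ?_ (fun l => ?_) i
    · simp only [Fin.cases_zero, aeval_X, map_zero]
    · simp only [Fin.cases_succ, aeval_X]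
      by_cases hl : l = j
      · simp only [hl, ↓reduceIte, aeval_X, Fin.cases_succ]
      · simp only [if_neg hl, map_mul, aeval_X, Fin.cases_succ]
  rw [← AlgHom.comp_apply, comp_aeval, ← AlgHom.comp_apply, comp_aeval, hfun]

/-- **The fibre restriction commutes with translations off `U₀`**: `ρ (P(U + (0, b))) = (ρ P)(V + b)`. [folklore] -/
theorem restrictFibre_translate (b : Fin 2 → k) (P : MvPolynomial (Fin 3) k) :
    aeval (Fin.cases (0 : MvPolynomial (Fin 2) k) (fun l => X l) : Fin 3 → MvPolynomial (Fin 2) k)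
      (translate (Fin.cases (0 : k) b : Fin 3 → k) P) =
    translate b (aeval (Fin.cases (0 : MvPolynomial (Fin 2) k) (fun l => X l) : Fin 3 → MvPolynomial (Fin 2) k) P) := by
  have hfun : (fun i : Fin 3 => aeval (Fin.cases (0 : MvPolynomial (Fin 2) k) (fun l => X l) : Fin 3 → MvPolynomial (Fin 2) k)
      ((fun i : Fin 3 => (X i + C ((Fin.cases (0 : k) b : Fin 3 → k) i) : MvPolynomial (Fin 3) k)) i)) =
      fun i : Fin 3 => aeval (fun l : Fin 2 => (X l + C (b l) : MvPolynomial (Fin 2) k))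
        ((Fin.cases (0 : MvPolynomial (Fin 2) k) (fun l => X l) : Fin 3 → MvPolynomial (Fin 2) k) i) := by
    funext i
    refine Fin.cases ?_ (fun l => ?_) i
    · simp only [Fin.cases_zero, aeval_X, map_zero, add_zero]
    · simp only [Fin.cases_succ, map_add, aeval_X, aeval_C, algebraMap_eq]
  rw [translate_eq_aeval, translate_eq_aeval, ← AlgHom.comp_apply, comp_aeval, ← AlgHom.comp_apply, comp_aeval, hfun]

/-- **Low homogeneous components stay zero under the fibre restriction** (its letters go to `0` or to letters). [folklore] -/
theorem lowOrder_restrictFibre {P : MvPolynomial (Fin 3) k} {μ : ℕ} (h : ∀ n < μ, homogeneousComponent n P = 0) :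
    ∀ n < μ, homogeneousComponent n
      (aeval (Fin.cases (0 : MvPolynomial (Fin 2) k) (fun l => X l) : Fin 3 → MvPolynomial (Fin 2) k) P) = 0 := by
  intro n hn
  have hlin : ∀ i : Fin 3, ((Fin.cases (0 : MvPolynomial (Fin 2) k) (fun l => X l) : Fin 3 → MvPolynomial (Fin 2) k) i)
      |>.IsHomogeneous 1 := by
    intro i
    refine Fin.cases ?_ (fun l => ?_) i
    · simp only [Fin.cases_zero]; exact isHomogeneous_zero _ _ _
    · simp only [Fin.cases_succ]; exact isHomogeneous_X _ _
  rw [homogeneousComponent_aeval_linear _ hlin, h n hn, map_zero]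

/-- **Nearness passes to the fibre**: if `c′` has order `≥ q` at the point `(U₀, U₁, U₂) = (0, b)` then `ρ c′` has order
`≥ q` at `b`. [folklore] -/
theorem lowOrder_translate_restrictFibre (b : Fin 2 → k) {c' : MvPolynomial (Fin 3) k} {q : ℕ}
    (h : ∀ n < q, homogeneousComponent n (translate (Fin.cases (0 : k) b : Fin 3 → k) c') = 0) :
    ∀ n < q, homogeneousComponent n (translate b
      (aeval (Fin.cases (0 : MvPolynomial (Fin 2) k) (fun l => X l) : Fin 3 → MvPolynomial (Fin 2) k) c')) = 0 := by
  rw [← restrictFibre_translate]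
  exact lowOrder_restrictFibre h

end Restrict

/-! ## §2. The binary `birthNear` -/

section Near

variable {k : Type} [Field k]

/-- **`birthNear₂` — the BINARY one-chart birth law** (index type `Fin 2`; the proof of p507123 §E verbatim): if
`c′·V_j^q = χ_j(c)` and `c′` has order `≥ q` at the point `b` of the exceptional divisor (`b_j = 0`), then the degree-`d`
form `in_d(c)` vanishes to order `2q − d` at `b̂ = (b, b_j := 1)`. NOT a statement of the manuscript. [folklore] -/
theorem birthNear₂ (q d : ℕ) (j : Fin 2) (b : Fin 2 → k) (c c' : MvPolynomial (Fin 2) k) (hbj : b j = 0)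
    (heq : c' * X j ^ q = aeval (fun l : Fin 2 => if l = j then (X j : MvPolynomial (Fin 2) k) else X j * X l) c)
    (hvan : ∀ n < q, homogeneousComponent n (translate b c') = 0) :
    ∀ n < 2 * q - d, homogeneousComponent n (translate (Function.update b j 1) (homogeneousComponent d c)) = 0 := by
  classical
  have hv : ∀ β : Fin 2 →₀ ℕ, β.degree < q → coeff β (translate b c') = 0 :=
    (forall_homogeneousComponent_eq_zero_iff _ _).mp hvan
  have hT : translate b c' * X j ^ q = chartTransform 0 j
      (aeval (fun l => if l = j then (X j : MvPolynomial (Fin 2) k) else X l + C (b l) * X j) c) := by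
    rw [← aeval_chart_eq_chartTransform, ← translate_aeval_chart j b hbj c, ← heq,
      translate_eq_aeval b (c' * X j ^ q), map_mul, map_pow, aeval_X, hbj, map_zero, add_zero]
    rfl
  have h1 : ∀ β : Fin 2 →₀ ℕ, β.degree < q + q → coeff β (chartTransform 0 j
      (aeval (fun l => if l = j then (X j : MvPolynomial (Fin 2) k) else X l + C (b l) * X j) c)) = 0 := by
    rw [← hT]; exact lowOrder_mul_X_pow j q hv
  have h2 : ∀ a ∈ (homogeneousComponent d
      (aeval (fun l => if l = j then (X j : MvPolynomial (Fin 2) k) else X l + C (b l) * X j) c)).support,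
      2 * q - d ≤ (a.erase j).degree := by
    intro a ha
    rw [mem_support_iff, coeff_homogeneousComponent] at ha
    split_ifs at ha with hadeg
    · have haG := mem_support_iff.mpr ha
      have hne := ha
      rw [← coeff_chartExponent_chartTransform 0 j (fun _ _ => Nat.zero_le _) haG] at hne
      have hge : q + q ≤ (chartExponent 0 j a).degree := not_lt.mp fun hlt => hne (h1 _ hlt)
      rw [degree_chartExponent, Nat.sub_zero] at hge
      have hsplit : (a.erase j).degree + a j = a.degree := by
        have h := congrArg Finsupp.degree (Finsupp.erase_add_single j a)
        rwa [map_add, Finsupp.degree_single] at h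
      omega
    · exact absurd rfl ha
  have h3 := lowOrder_translate_single_of_erase_degree j h2
  rw [homogeneousComponent_aeval_linear _ (isHomogeneous_shear j b), translate_single_aeval_shear] at h3
  intro n hn
  have hP := (forall_homogeneousComponent_eq_zero_iff _ _).mpr h3 n hn
  have h5 := congrArg (aeval (fun l => if l = j then (X j : MvPolynomial (Fin 2) k) else X l - C (b l) * X j)) hP
  rw [map_zero, ← homogeneousComponent_aeval_linear _ (isHomogeneous_unshear j b), aeval_unshear_aeval_shear] at h5
  exact h5

end Near

/-! ## §3. The binary `birthTidy` and the one-step curve-centre law -/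

section Tidy

variable {k : Type} [Field k]

/-- **`birthTidy₂` — the BINARY tidy law**: a non-zero binary form of degree `d` with `d < 2μ` does not vanish to order `μ`
at two linearly independent vectors (in the frame of the two vectors every monomial `V^s` has `μ + s₀ ≤ d` and `μ + s₁ ≤ d`).
NOT a statement of the manuscript. [folklore] -/
theorem birthTidy₂ (F : MvPolynomial (Fin 2) k) (d μ : ℕ) (hF : F.IsHomogeneous d) (hF0 : F ≠ 0) (hlt : d < 2 * μ)
    (b : Fin 2 → (Fin 2 → k)) (hb : LinearIndependent k b)
    (hvan : ∀ t : Fin 2, ∀ n < μ, homogeneousComponent n (translate (b t) F) = 0) : False := by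
  classical
  let M : Matrix (Fin 2) (Fin 2) k := Matrix.of fun i t => b t i
  have hcol : M.col = b := rfl
  have hMunit : IsUnit M := Matrix.linearIndependent_cols_iff_isUnit.mp (hcol ▸ hb)
  have hMdet : IsUnit M.det := (Matrix.isUnit_iff_isUnit_det M).mp hMunit
  set G : MvPolynomial (Fin 2) k := aeval M.toMvPolynomial F with hGdef
  have hG : G.IsHomogeneous d := isHomogeneous_aeval_linear _ (fun j => M.toMvPolynomial_isHomogeneous j) hF
  have hG0 : G ≠ 0 := by
    intro h0
    apply hF0
    rw [← aeval_toMvPolynomial_aeval_toMvPolynomial_of_mul_eq_one M M⁻¹ (Matrix.mul_nonsing_inv M hMdet) F, ← hGdef, h0,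
      map_zero]
  have hGvan : ∀ t : Fin 2, ∀ β : Fin 2 →₀ ℕ, β.degree < μ → coeff β (translate (Pi.single t 1) G) = 0 := by
    intro t
    rw [← forall_homogeneousComponent_eq_zero_iff]
    intro n hn
    have hMv : M.mulVec (Pi.single t 1) = b t := by rw [Matrix.mulVec_single_one, hcol]
    rw [hGdef, translate_aeval_toMvPolynomial, hMv,
      homogeneousComponent_aeval_linear _ (fun j => M.toMvPolynomial_isHomogeneous j), hvan t n hn, map_zero]
  obtain ⟨s, hs⟩ := exists_coeff_ne_zero hG0
  have hs' : s ∈ G.support := mem_support_iff.mpr hs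
  have h0 := add_apply_le_of_lowOrder_translate_single hG 0 (hGvan 0) hs'
  have h1 := add_apply_le_of_lowOrder_translate_single hG 1 (hGvan 1) hs'
  have hdeg : s 0 + s 1 = d := by
    have h : s.degree = d := by rw [Finsupp.degree_eq_weight_one]; exact hG hs
    rwa [Finsupp.degree_eq_sum, Fin.sum_univ_two] at h
  omega

/-- [OURS · L1 W4.2] **ONE-STEP CURVE-CENTRE BIRTH LAW (fibre over `x_n`, band `3d < 4q`).** One transversal coefficient
`c ∈ k[V₀, V₁]` of the graded datum restricted to the fibre (`q = m − i`, `d = ord c`, `in_d(c) ≠ 0`, `δ = d/q < 4/3`): two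
points of the exceptional `ℙ¹ = ℙ(Dir/T_D)`, each NEAR in its own chart `V_{j_t} ≠ 0` (`b^t_{j_t} = 0`, `c′_t·V_{j_t}^q = χ_{j_t}(c)`,
`c′_t` of order `≥ q` at `b^t`), never have linearly independent directions `b̂^t`: AT MOST ONE near direction over `x_n`.
Hence a RULED fibre birth («`ℙ¹` wholly near») below `4/3` needs `in_d(c) = 0` ON THE FIBRE, i.e. the `D`-transversal initial
form of `c` vanishes at the point `x_n ∈ D`. Proof: `birthNear₂` twice + `birthTidy₂`. NOT a statement of the manuscript. [folklore] -/
theorem not_linearIndependent_of_near₂ {q d : ℕ} {c : MvPolynomial (Fin 2) k} (hF : homogeneousComponent d c ≠ 0)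
    (hband : 3 * d < 4 * q) (j : Fin 2 → Fin 2) (b : Fin 2 → (Fin 2 → k)) (c' : Fin 2 → MvPolynomial (Fin 2) k)
    (hbj : ∀ t, b t (j t) = 0)
    (hchart : ∀ t, c' t * X (j t) ^ q =
      aeval (fun l : Fin 2 => if l = j t then (X (j t) : MvPolynomial (Fin 2) k) else X (j t) * X l) c)
    (hnear : ∀ t, ∀ n < q, homogeneousComponent n (translate (b t) (c' t)) = 0) :
    ¬ LinearIndependent k (fun t => Function.update (b t) (j t) 1) := fun hli =>
  birthTidy₂ (homogeneousComponent d c) d (2 * q - d) (homogeneousComponent_isHomogeneous d c) hF (by omega)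
    (fun t => Function.update (b t) (j t) 1) hli
    fun t => birthNear₂ q d (j t) (b t) c (c' t) (hbj t) (hchart t) (hnear t)

end Tidy

/-! ## §4. A RULED birth kills the transversal initial form (append 2026-08-27, res-D-pv-002; §1–§3 byte-identical
to p514049): over an infinite field, «`ℙ¹` WHOLLY near» with a positive vanishing order forces the binary form to be `0` — the
(B0) «plane birth needs `δ ≥ 2`» of idea-1's §8 in its curve-centre form: a ruled fibre birth over `x_n ∈ D` for an index with
`δ_i < 2` needs the `D`-transversal initial form of `c_i` to VANISH at the point `x_n` of `D`. -/

section Ruled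

variable {k : Type} [Field k]

/-- The constant term of `P(V + v)` is `P(v)`. [folklore] -/
theorem coeff_zero_translate_eq_eval (v : Fin 2 → k) (P : MvPolynomial (Fin 2) k) :
    coeff 0 (translate v P) = eval v P := by
  have h : constantCoeff.comp (aeval fun i => (X i + C (v i) : MvPolynomial (Fin 2) k)).toRingHom = eval v := by
    refine MvPolynomial.ringHom_ext (fun r => ?_) (fun i => ?_)
    · simp
    · simp
  exact DFunLike.congr_fun h P

/-- A direction near to a POSITIVE order is a zero of the form. [folklore] -/
theorem eval_eq_zero_of_near (w : Fin 2 → k) {F : MvPolynomial (Fin 2) k} {μ : ℕ} (hμ : 1 ≤ μ)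
    (h : ∀ n < μ, homogeneousComponent n (translate w F) = 0) : eval w F = 0 := by
  have h0 := h 0 (by omega)
  rw [homogeneousComponent_zero, coeff_zero_translate_eq_eval] at h0
  exact (C_eq_zero (σ := Fin 2)).mp h0

/-- [OURS · L1 W4.2] **A RULED BIRTH KILLS THE TRANSVERSAL INITIAL FORM.** Over an INFINITE field: if a binary form `F` of degree
`d` vanishes to a positive order `μ ≥ 1` (`δ < 2`) at EVERY direction of `ℙ¹` — every point `b̂ = (b, b_j := 1)`, `b_j = 0`, of
both charts `j ∈ {0, 1}` («`ℙ¹` wholly near», the ruled fibre-birth event over a point of a curve centre) — then `F = 0`.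
(Every vector is a scalar multiple of such a `b̂`, forms scale — `aeval_smul_of_isHomogeneous` —, and a polynomial vanishing at
every point of an infinite field is zero — `MvPolynomial.funext`.) Over a FINITE residue field apply it after base change to an
infinite extension (the dictionary quantifies over all field extensions). NOT a statement of the manuscript. [folklore] -/
theorem eq_zero_of_wholly_near₂ [Infinite k] {F : MvPolynomial (Fin 2) k} {d μ : ℕ} (hF : F.IsHomogeneous d) (hμ : 1 ≤ μ)
    (h : ∀ (j : Fin 2) (b : Fin 2 → k), b j = 0 →
      ∀ n < μ, homogeneousComponent n (translate (Function.update b j 1) F) = 0) :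
    F = 0 := by
  -- every near direction is a zero of `F`
  have hz : ∀ (j : Fin 2) (b : Fin 2 → k), b j = 0 → eval (Function.update b j 1) F = 0 :=
    fun j b hb => eval_eq_zero_of_near _ hμ (h j b hb)
  -- every vector is a multiple of a near direction, and forms scale
  have hscale : ∀ (c : k) (w : Fin 2 → k), eval (c • w) F = c ^ d * eval w F := fun c w => by
    exact aeval_smul_of_isHomogeneous (A := k) hF c w
  apply MvPolynomial.funext
  intro x
  rw [map_zero]
  by_cases hx : x 0 = 0
  · -- `x = x₁ • (0, 1)`, and `(0, 1)` is the direction `b̂` of chart `1` at `b = 0`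
    have hx' : x = x 1 • Function.update (0 : Fin 2 → k) 1 1 := by
      funext i
      fin_cases i
      · simp [hx]
      · simp
    rw [hx', hscale, hz 1 0 rfl, mul_zero]
  · -- `x = x₀ • (1, x₁/x₀)`, the direction `b̂` of chart `0` at `b = (0, x₁/x₀)`
    have hx' : x = x 0 • Function.update (Function.update (0 : Fin 2 → k) 1 (x 1 / x 0)) 0 1 := by
      funext i
      fin_cases i
      · simp
      · simp [mul_div_cancel₀ _ hx]
    rw [hx', hscale, hz 0 _ (by simp), mul_zero]

end Ruled

end Summit.ResolutionOfSingularities.ResolutionOfSingularities.Theorems.SigmaMaxModificationsCorridor3.Birth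

end
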